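import Summits.SmoothPoincare4.SmoothPoincare4.Theorems.DottedCircleRasmussenDcrGapHelperHandlebodyChartModelHandlesCollarAux

/-!
# Helper `helper_handlebodyChart_modelHandles` (M3: handle structure of the model dotted handlebody `D_k`)
# of line `mk_friends` for crux `DcrGap` — collar push, part 2: the push
(item stmt-SmoothPoincare4-16128, route route-SmoothPoincare4-DottedCircleRasmussen)

**Registered piece `helper_handlebodyChart_modelHandles_collar` of the model lemma M3.**  For every
open `U ⊇ D_k = MMSW.modelHandlebody k` there is a diffeomorphism `κ` of `ℝ⁴` which is the identity off
a compact `K ⊆ U`, carries `D_k` into `D_k ∩ {G_k ≤ 24/25}`, and commutes with the rotations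
`(z, w) ↦ (z, u w)` (`|u| = 1`) of the `w`-plane.  This is the first stage of the squeeze `κ` of M3
(after it, every further model isotopy can be supported in the FIXED compact `D_k`, independently of
`U`), and its equivariance is what makes the conjugate of a fibre twist by the squeeze again a fibre
rotation (the twist-compatibility clause of M3).

Proof (`ModelHandles.exists_collar_push`): `κ` is the time-`1/20` map of the flow of the inward field
`V = -φ_m(G_k) ∇G_k / |∇G_k|²` cut off to the half-guard zone, where `φ_m = 1` on the band
`24/25 ≤ G_k ≤ 1 + m` and the band `{guard ≥ 1/2, G_k ≤ 1 + 2m}` lies in `U`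
(`exists_band_subset`).  The field is smooth: where `φ_m(G_k) ≠ 0` one has `G_k > 191/200`, and there
`∇G_k ≠ 0` — either `|w|² > 1/200`, or the planar potential is `≥ 19/20` and `MMSW.gradSq_pos`
(the critical values of `G_k` lie below `19/20`) applies.  Along the flow `dG_k/dt = -φ_m(G_k) ≤ 0`, with
equality `-1` as long as the orbit is in the band; so an orbit starting in `D_k` stays in `{G_k ≤ 1}`
(hence in the guard) and reaches `{G_k ≤ 24/25}` by time `1/20` — Milnor's push through a regular
band (Morse theory, Thm. 3.1).  The rotations of the `w`-plane preserve `G_k`, the hole terms and the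
gradient, so they commute with `V` and hence with the flow (`exists_flow_package`).

No definitions, no named facts, no `sorry`.

References: J. Milnor, *Morse Theory* (1963), Thm. 3.1 [Milnor1963]; J. M. Lee, *Introduction to Smooth
Manifolds*, 2nd ed. (2012), Thm. 9.12, 9.16 [LeeSmoothManifolds2013].
-/

-- the prescribed namespace `Summit.<P>.<Sub>.…` duplicates `SmoothPoincare4` (P = Sub)
set_option linter.dupNamespace false

noncomputable section

open scoped Manifold ContDiff Topology NNReal
open Function Set Metric Filter
open Literature.Topology.FourManifolds Literature.Topology.FourManifolds.MMSW
open Literature.AlgebraicTopology.Homotopy.HopfFibration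

namespace Summit.SmoothPoincare4.SmoothPoincare4.Theorems.DcrGap.MkFriends

namespace ModelHandles

/-! ## The collar push -/

/-- **The collar push of the model handlebody.**  For every open `U ⊇ D_k` there is a
diffeomorphism `κ` of `ℝ⁴`, the identity off a compact `K ⊆ U`, carrying `D_k` into
`D_k ∩ {G_k ≤ 24/25}`, and commuting with the rotations of the `w`-plane.  It is the time-`1/20`
map of the flow of the inward field `-φ ∇G_k/|∇G_k|²` (`φ` a cutoff equal to `1` on the regular
band `24/25 ≤ G_k ≤ 1 + m` and supported in `U`; `∇G_k ≠ 0` there since the critical values of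
`G_k` lie below `19/20`, `MMSW.gradSq_pos`), along which `G_k` decreases at unit speed through the
band — Milnor's push through a regular band (Morse theory, Thm. 3.1), here into the sublevel set.
[cite: Milnor1963, Thm. 3.1] -/
theorem exists_collar_flow (k : ℕ) {U : Set (EuclideanSpace ℝ (Fin 4))} (hUo : IsOpen U)
    (hDU : modelHandlebody k ⊆ U) :
    ∃ (θ : ℝ × EuclideanSpace ℝ (Fin 4) → EuclideanSpace ℝ (Fin 4))
      (V : EuclideanSpace ℝ (Fin 4) → EuclideanSpace ℝ (Fin 4)) (K : Set (EuclideanSpace ℝ (Fin 4))),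
      ContDiff ℝ ∞ θ ∧ (∀ x, θ (0, x) = x) ∧ (∀ t s x, θ (t, θ (s, x)) = θ (t + s, x)) ∧
      (∀ x t, HasDerivAt (fun t => θ (t, x)) (V (θ (t, x))) t) ∧ Continuous V ∧
      IsCompact K ∧ K ⊆ U ∧ (∀ x, x ∉ K → V x = 0) ∧ (∀ x, x ∉ K → ∀ t, θ (t, x) = x) ∧
      (∀ s, ∃ Φ : EuclideanSpace ℝ (Fin 4) ≃ₘ⟮𝓡 4, 𝓡 4⟯ EuclideanSpace ℝ (Fin 4), ∀ x, Φ x = θ (s, x)) ∧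
      (∀ u : ℂ, ‖u‖ = 1 → ∀ t x, θ (t, fibreRot (fun _ => u) x) = fibreRot (fun _ => u) (θ (t, x))) ∧
      (∀ x ∈ K, ∀ t, θ (t, x) ∈ K) ∧ (∀ y ∈ K, ∀ j : Fin k, (1 : ℝ) / 2 ≤ holeTerm k j y) ∧
      modelHandlebody k ⊆ K ∧
      ∀ x ∈ modelHandlebody k, θ (1 / 20, x) ∈ modelHandlebody k ∧
        levelFun k (θ (1 / 20, x)) ≤ 24 / 25 := by
  obtain ⟨m, hm0, hm4, hmU⟩ := exists_band_subset k hUo hDU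
  -- the cutoff, the half-gradient, the field
  set φ : ℝ → ℝ := fun g => Real.smoothTransition (200 * (g - 191 / 200)) *
    Real.smoothTransition ((1 + 2 * m - g) / m) with hφ
  set a : EuclideanSpace ℝ (Fin 4) → ℝ := fun y => y 0 / (40 * ((k : ℝ) + 1)) ^ 2 -
    ∑ j : Fin k, (y 0 - 4 * (((j : ℕ) : ℝ) + 1)) / holeTerm k j y ^ 2 with ha
  set b : EuclideanSpace ℝ (Fin 4) → ℝ := fun y => y 1 / (40 * ((k : ℝ) + 1)) ^ 2 -
    ∑ j : Fin k, y 1 / holeTerm k j y ^ 2 with hb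
  set gradG : EuclideanSpace ℝ (Fin 4) → EuclideanSpace ℝ (Fin 4) :=
    fun y => !₂[a y, b y, y 2, y 3] with hgradG
  set S : EuclideanSpace ℝ (Fin 4) → ℝ := fun y => a y ^ 2 + b y ^ 2 + y 2 ^ 2 + y 3 ^ 2 with hS
  set χ : EuclideanSpace ℝ (Fin 4) → ℝ :=
    fun y => if ∀ j : Fin k, (1 : ℝ) / 4 < holeTerm k j y then φ (levelFun k y) else 0 with hχ
  set V : EuclideanSpace ℝ (Fin 4) → EuclideanSpace ℝ (Fin 4) :=
    fun y => (-(χ y) / (2 * S y)) • gradG y with hV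
  -- the support set
  set K : Set (EuclideanSpace ℝ (Fin 4)) := {y | (∀ j : Fin k, (1 : ℝ) / 2 ≤ holeTerm k j y) ∧
    levelFun k y ≤ 1 + 2 * m} with hK
  have hKU : K ⊆ U := hmU
  have hKc : IsCompact K := by
    have hKeq : K = {y : EuclideanSpace ℝ (Fin 4) | ∀ j : Fin k, (1 : ℝ) / 2 ≤ holeTerm k j y} ∩
        levelFun k ⁻¹' Iic (1 + 2 * m) := rfl
    refine Metric.isCompact_of_isClosed_isBounded ?_ ?_
    · rw [hKeq]
      exact (continuousOn_levelFun (by norm_num : (0 : ℝ) < 1 / 2)).preimage_isClosed_of_isClosed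
        (isClosed_guard (1 / 2)) isClosed_Iic
    · refine (isBounded_closedBall (x := (0 : EuclideanSpace ℝ (Fin 4)))
        (r := 2 * (40 * ((k : ℝ) + 1)))).subset fun y hy => mem_closedBall_zero_iff.2 ?_
      have hpos : ∀ j, 0 < holeTerm k j y := fun j => lt_of_lt_of_le (by norm_num) (hy.1 j)
      have h1 := FriendsH2.norm_sq_le_levelFun hpos
      have hk : (0 : ℝ) ≤ k := k.cast_nonneg
      have hR : (40 : ℝ) ≤ 40 * ((k : ℝ) + 1) := by nlinarith
      have h5 : ‖y‖ ^ 2 ≤ (2 * (40 * ((k : ℝ) + 1))) ^ 2 := by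
        have h2 : levelFun k y * ((40 * ((k : ℝ) + 1)) ^ 2 + 1) ≤
            (1 + 2 * m) * ((40 * ((k : ℝ) + 1)) ^ 2 + 1) :=
          mul_le_mul_of_nonneg_right hy.2 (by positivity)
        nlinarith [norm_nonneg y]
      exact le_of_pow_le_pow_left₀ two_ne_zero (by positivity) h5
  -- `dG(gradG) = 2 S`
  have hfd : ∀ y, (∀ j, holeTerm k j y ≠ 0) → fderiv ℝ (levelFun k) y (gradG y) = 2 * S y := by
    intro y hy
    rw [fderiv_levelFun_apply hy]
    simp only [hgradG, hS, ha, hb]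
    simp
    ring
  -- `S > 0` on `{G ≥ 191/200}`
  have hSpos : ∀ y, (∀ j, holeTerm k j y ≠ 0) → 191 / 200 ≤ levelFun k y → 0 < S y := by
    intro y hy hG
    by_cases hg : 19 / 20 ≤ levelFun k y - ((y 2) ^ 2 + (y 3) ^ 2)
    · have h := gradSq_pos hy hg
      simp only [hS, ha, hb]
      nlinarith [sq_nonneg (y 2), sq_nonneg (y 3)]
    · push Not at hg
      have h1 : 0 < (y 2) ^ 2 + (y 3) ^ 2 := by linarith
      simp only [hS]
      nlinarith [sq_nonneg (a y), sq_nonneg (b y)]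
  -- the cutoff `χ`
  have hχ01 : ∀ y, 0 ≤ χ y ∧ χ y ≤ 1 := by
    intro y
    simp only [hχ]
    split_ifs
    · exact ⟨(collarCutoff_mem_Icc m _).1, (collarCutoff_mem_Icc m _).2⟩
    · exact ⟨le_rfl, zero_le_one⟩
  have hχne : ∀ y, χ y ≠ 0 → (∀ j, (1 : ℝ) / 4 < holeTerm k j y) ∧
      191 / 200 < levelFun k y ∧ levelFun k y < 1 + 2 * m := by
    intro y h
    simp only [hχ] at h
    split_ifs at h with h4
    · exact ⟨h4, collarCutoff_ne_zero hm0 h⟩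
    · exact absurd rfl h
  have hχeq : ∀ y, (∀ j, (1 : ℝ) / 4 < holeTerm k j y) → χ y = φ (levelFun k y) := fun y h => by
    simp only [hχ, if_pos h]
  have hpos4 : ∀ y, (∀ j, (1 : ℝ) / 4 < holeTerm k j y) → ∀ j, 0 < holeTerm k j y :=
    fun y h j => lt_trans (by norm_num) (h j)
  -- smoothness of the field
  have hgrad : ∀ y, (∀ j, holeTerm k j y ≠ 0) → ContDiffAt ℝ ∞ gradG y := by
    intro y hy
    rw [contDiffAt_euclidean]
    intro i
    fin_cases i
    · simpa [hgradG] using contDiffAt_gRe hy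
    · simpa [hgradG] using contDiffAt_gIm hy
    · simp [hgradG]; fun_prop
    · simp [hgradG]; fun_prop
  have hScd : ∀ y, (∀ j, holeTerm k j y ≠ 0) → ContDiffAt ℝ ∞ S y := by
    intro y hy
    simp only [hS]
    exact ((((contDiffAt_gRe hy).pow 2).add ((contDiffAt_gIm hy).pow 2)).add
      ((contDiffAt_euclidean.1 contDiffAt_id (2 : Fin 4)).pow 2)).add
      ((contDiffAt_euclidean.1 contDiffAt_id (3 : Fin 4)).pow 2)
  have hVs : ContDiff ℝ ∞ V := by
    rw [contDiff_iff_contDiffAt]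
    intro y
    by_cases hy4 : ∀ j : Fin k, (1 : ℝ) / 4 < holeTerm k j y
    · have hy0 : ∀ j, holeTerm k j y ≠ 0 := fun j => (hpos4 y hy4 j).ne'
      have hev : V =ᶠ[𝓝 y] fun y' => (-(φ (levelFun k y')) / (2 * S y')) • gradG y' := by
        filter_upwards [(isOpen_guard (1 / 4)).mem_nhds hy4] with y' hy'
        simp only [hV, hχeq y' hy']
      by_cases hG : 191 / 200 ≤ levelFun k y
      · refine ContDiffAt.congr_of_eventuallyEq ?_ hev
        have hS0 : 2 * S y ≠ 0 := by have := hSpos y hy0 hG; positivity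
        exact ((((collarCutoff_contDiff m).contDiffAt.comp y (contDiffAt_levelFun hy0)).neg.div
          (contDiffAt_const.mul (hScd y hy0)) hS0).smul (hgrad y hy0))
      · push Not at hG
        have hev0 : V =ᶠ[𝓝 y] fun _ => 0 := by
          have hGc : ContinuousAt (levelFun k) y := (contDiffAt_levelFun hy0).continuousAt
          filter_upwards [hev, hGc.preimage_mem_nhds (Iio_mem_nhds hG)] with y' hy' hG'
          rw [hy']
          have : φ (levelFun k y') = 0 := by
            by_contra h
            exact absurd (collarCutoff_ne_zero hm0 h).1 (not_lt.2 (le_of_lt hG'))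
          rw [this, neg_zero, zero_div, zero_smul]
        exact (contDiffAt_const (c := (0 : EuclideanSpace ℝ (Fin 4)))).congr_of_eventuallyEq hev0
    · push Not at hy4
      obtain ⟨j, hj⟩ := hy4
      have hev : V =ᶠ[𝓝 y] fun _ => 0 := by
        have hopen : IsOpen {y' : EuclideanSpace ℝ (Fin 4) | holeTerm k j y' < 1 / 2} :=
          isOpen_lt (continuous_holeTerm j) continuous_const
        filter_upwards [hopen.mem_nhds (show holeTerm k j y < 1 / 2 by linarith)]
          with y' hy'
        have hχ0 : χ y' = 0 := by
          by_contra h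
          obtain ⟨h4, -, hlt⟩ := hχne y' h
          have h2 := (FriendsH2.levelFun_bounds (hpos4 y' h4)).2.2 j
          have h3 : 2 < 1 / holeTerm k j y' := by
            rw [lt_one_div two_pos (hpos4 y' h4 j)]; exact hy'
          linarith
        simp only [hV, hχ0, neg_zero, zero_div, zero_smul]
      exact (contDiffAt_const (c := (0 : EuclideanSpace ℝ (Fin 4)))).congr_of_eventuallyEq hev
  -- support
  have hVK : ∀ y, y ∉ K → V y = 0 := by
    intro y hy
    by_contra h
    have hχ0 : χ y ≠ 0 := fun h0 => h (by simp only [hV, h0, neg_zero, zero_div, zero_smul])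
    obtain ⟨h4, hG1, hG2⟩ := hχne y hχ0
    exact hy ⟨fun j => (FriendsH2.half_lt_holeTerm_of_levelFun_lt_two (hpos4 y h4)
      (by linarith) j).le, hG2.le⟩
  -- equivariance of the field under the rotations of the `w`-plane
  have hVrot : ∀ u : ℂ, ‖u‖ = 1 → ∀ (L : EuclideanSpace ℝ (Fin 4) →L[ℝ] EuclideanSpace ℝ (Fin 4)),
      (∀ y, L y = fibreRot (fun _ => u) y) → ∀ y, V (L y) = L (V y) := by
    intro u hu L hL y
    have hu2 : u.re ^ 2 + u.im ^ 2 = 1 := by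
      have h := Complex.normSq_eq_norm_sq u
      rw [hu, one_pow, Complex.normSq_apply] at h
      nlinarith
    have hT : ∀ j, holeTerm k j (L y) = holeTerm k j y := fun j => by
      rw [hL]; exact holeTerm_fibreRot _ j y
    have hGy : levelFun k (L y) = levelFun k y := by
      rw [hL]; exact levelFun_fibreRot (by simpa using hu)
    have hy0 : L y 0 = y 0 := by rw [hL]; simp [fibreRot]
    have hy1 : L y 1 = y 1 := by rw [hL]; simp [fibreRot]
    have hy2 : L y 2 = y 2 * u.re - y 3 * u.im := by rw [hL]; simp [fibreRot, Complex.mul_re]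
    have hy3 : L y 3 = y 2 * u.im + y 3 * u.re := by rw [hL]; simp [fibreRot, Complex.mul_im]
    have hay : a (L y) = a y := by simp only [ha, hy0, hT]
    have hby : b (L y) = b y := by simp only [hb, hy1, hT]
    have hSy : S (L y) = S y := by
      simp only [hS, hay, hby, hy2, hy3]
      nlinarith
    have hχy : χ (L y) = χ y := by simp only [hχ, hT, hGy]
    have hgy : gradG (L y) = L (gradG y) := by
      rw [hL (gradG y)]
      ext i
      fin_cases i <;> simp [hgradG, fibreRot, hay, hby, hy2, hy3, Complex.mul_re, Complex.mul_im]
    show (-(χ (L y)) / (2 * S (L y))) • gradG (L y) = L ((-(χ y) / (2 * S y)) • gradG y)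
    rw [hχy, hSy, hgy, L.map_smul]
  -- the flow package
  obtain ⟨θ, hθs, h0, hadd, hint, -, hfixK, hstage, hcomm⟩ := exists_flow_package hVs hKc hVK
  -- orbits do not leave `K`
  have hDK : modelHandlebody k ⊆ K := fun x hx => ⟨fun j => by linarith [hx.1 j], by linarith [hx.2]⟩
  have horbK : ∀ x ∈ K, ∀ t, θ (t, x) ∈ K := by
    intro x hxK t
    by_contra h
    have h1 := hfixK _ h (-t)
    rw [hadd, neg_add_cancel, h0] at h1
    exact h (h1 ▸ hxK)
  -- orbits of points of `D_k`
  have horbit : ∀ x ∈ modelHandlebody k,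
      θ (1 / 20, x) ∈ modelHandlebody k ∧ levelFun k (θ (1 / 20, x)) ≤ 24 / 25 := by
    intro x hx
    have horb : ∀ t, θ (t, x) ∈ K := horbK x (hDK hx)
    have hposT : ∀ t j, 0 < holeTerm k j (θ (t, x)) := fun t j =>
      lt_of_lt_of_le (by norm_num) ((horb t).1 j)
    have h4 : ∀ t j, (1 : ℝ) / 4 < holeTerm k j (θ (t, x)) := fun t j =>
      lt_of_lt_of_le (by norm_num) ((horb t).1 j)
    have hne : ∀ t j, holeTerm k j (θ (t, x)) ≠ 0 := fun t j => (hposT t j).ne'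
    -- `G` along the orbit decreases at speed `χ`
    have hg : ∀ t, HasDerivAt (fun t => levelFun k (θ (t, x))) (-(χ (θ (t, x)))) t := by
      intro t
      have hG : HasFDerivAt (levelFun k) (fderiv ℝ (levelFun k) (θ (t, x))) (θ (t, x)) :=
        ((contDiffAt_levelFun (hne t)).differentiableAt (by simp)).hasFDerivAt
      have h := hG.comp_hasDerivAt t (hint x t)
      have hval : fderiv ℝ (levelFun k) (θ (t, x)) (V (θ (t, x))) = -(χ (θ (t, x))) := by
        simp only [hV, map_smul, smul_eq_mul, hfd _ (hne t)]
        by_cases hS0 : S (θ (t, x)) = 0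
        · have hχ0 : χ (θ (t, x)) = 0 := by
            by_contra hc
            have := hSpos _ (hne t) (hχne _ hc).2.1.le
            exact absurd hS0 this.ne'
          rw [hχ0, hS0]; simp
        · field_simp
      rwa [hval] at h
    have hanti : Antitone fun t => levelFun k (θ (t, x)) :=
      antitone_of_deriv_nonpos (fun t => (hg t).differentiableAt) fun t => by
        rw [(hg t).deriv]; linarith [(hχ01 (θ (t, x))).1]
    have hG1 : ∀ t, 0 ≤ t → levelFun k (θ (t, x)) ≤ 1 := by
      intro t ht
      have := hanti ht
      simp only [h0] at this
      exact this.trans hx.2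
    have hmem : ∀ t, 0 ≤ t → θ (t, x) ∈ modelHandlebody k := by
      intro t ht
      refine ⟨fun j => ?_, hG1 t ht⟩
      have h := ((FriendsH2.levelFun_bounds (hposT t)).2.2 j).trans (hG1 t ht)
      rwa [one_div_le (hposT t j) one_pos, div_one] at h
    refine ⟨hmem _ (by norm_num), ?_⟩
    by_contra hgt
    push Not at hgt
    have hband : ∀ t ∈ Icc (0 : ℝ) (1 / 20), 24 / 25 < levelFun k (θ (t, x)) := fun t ht =>
      hgt.trans_le (hanti ht.2)
    have hχ1 : ∀ t ∈ Icc (0 : ℝ) (1 / 20), χ (θ (t, x)) = 1 := by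
      intro t ht
      rw [hχeq _ (h4 t)]
      exact collarCutoff_eq_one hm0 (hband t ht).le (by linarith [hG1 t ht.1])
    have hcont : ContinuousOn (fun t => levelFun k (θ (t, x)) + t) (Icc 0 (1 / 20)) :=
      fun t _ => ((hg t).continuousAt.add continuousAt_id).continuousWithinAt
    have hderiv : ∀ t ∈ Ico (0 : ℝ) (1 / 20),
        HasDerivWithinAt (fun t => levelFun k (θ (t, x)) + t) 0 (Ici t) t := by
      intro t ht
      have h : HasDerivAt (fun t => levelFun k (θ (t, x)) + t) (-(χ (θ (t, x))) + 1) t :=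
        (hg t).add (hasDerivAt_id t)
      rw [hχ1 t ⟨ht.1, ht.2.le⟩, neg_add_cancel] at h
      exact h.hasDerivWithinAt
    have hconst := constant_of_has_deriv_right_zero hcont hderiv (1 / 20)
      ⟨by norm_num, le_rfl⟩
    simp only [h0, add_zero] at hconst
    have h20 := hband (1 / 20) ⟨by norm_num, le_rfl⟩
    linarith [hx.2]
  -- conclusion
  refine ⟨θ, V, K, hθs, h0, hadd, hint, hVs.continuous, hKc, hKU, hVK, hfixK, fun s => ?_,
    fun u hu t x => ?_, horbK, fun y hy => hy.1, hDK, horbit⟩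
  · obtain ⟨Φ, hΦ⟩ := hstage s
    exact ⟨Φ, hΦ⟩
  · obtain ⟨L, hL⟩ := exists_clm_fibreRot_const u
    rw [← hL, ← hL]
    exact hcomm L (hVrot u hu L hL) _ _

/-- **The collar push of the model handlebody** (stage form of `exists_collar_flow`): for every open
`U ⊇ D_k` a diffeomorphism `κ` of `ℝ⁴`, the identity off a compact `K ⊆ U`, carrying `D_k` into
`D_k ∩ {G_k ≤ 24/25}` and commuting with the rotations of the `w`-plane — the time-`1/20` map of the
flow. [cite: Milnor1963, Thm. 3.1] -/
theorem exists_collar_push (k : ℕ) {U : Set (EuclideanSpace ℝ (Fin 4))} (hUo : IsOpen U)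
    (hDU : modelHandlebody k ⊆ U) :
    ∃ (κ : EuclideanSpace ℝ (Fin 4) ≃ₘ⟮𝓡 4, 𝓡 4⟯ EuclideanSpace ℝ (Fin 4))
      (K : Set (EuclideanSpace ℝ (Fin 4))), IsCompact K ∧ K ⊆ U ∧ (∀ x, x ∉ K → κ x = x) ∧
      (∀ x ∈ modelHandlebody k, κ x ∈ modelHandlebody k ∧ levelFun k (κ x) ≤ 24 / 25) ∧
      ∀ u : ℂ, ‖u‖ = 1 → ∀ x, κ (fibreRot (fun _ => u) x) = fibreRot (fun _ => u) (κ x) := by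
  obtain ⟨θ, V, K, -, -, -, -, -, hKc, hKU, -, hfixK, hstage, hcomm, -, -, -, horbit⟩ :=
    exists_collar_flow k hUo hDU
  obtain ⟨Φ, hΦ⟩ := hstage (1 / 20)
  refine ⟨Φ, K, hKc, hKU, fun x hx => ?_, fun x hx => ?_, fun u hu x => ?_⟩
  · rw [hΦ]; exact hfixK x hx _
  · rw [hΦ]; exact horbit x hx
  · rw [hΦ, hΦ]; exact hcomm u hu _ _

end ModelHandles

/-- **Registered piece `helper_handlebodyChart_modelHandles_collar` of the model lemma M3 (the collar
push of the model dotted handlebody)**: for every open `U ⊇ D_k` a diffeomorphism of `ℝ⁴`, the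
identity off a compact `K ⊆ U`, carrying `D_k` into `D_k ∩ {G_k ≤ 24/25}` and commuting with the
rotations of the `w`-plane — the time-`1/20` map of the cut-off flow of `-∇G_k/|∇G_k|²` through the
regular band above `24/25` (`ModelHandles.exists_collar_push`). [cite: Milnor1963, Thm. 3.1] -/
theorem helper_handlebodyChart_modelHandles_collar : ∀ (k : ℕ) (U : Set (EuclideanSpace ℝ (Fin 4))), IsOpen U → Literature.Topology.FourManifolds.MMSW.modelHandlebody k ⊆ U → ∃ (κ : EuclideanSpace ℝ (Fin 4) ≃ₘ⟮𝓡 4, 𝓡 4⟯ EuclideanSpace ℝ (Fin 4)) (K : Set (EuclideanSpace ℝ (Fin 4))), IsCompact K ∧ K ⊆ U ∧ (∀ x, x ∉ K → κ x = x) ∧ (∀ x ∈ Literature.Topology.FourManifolds.MMSW.modelHandlebody k, κ x ∈ Literature.Topology.FourManifolds.MMSW.modelHandlebody k ∧ Literature.Topology.FourManifolds.MMSW.levelFun k (κ x) ≤ 24 / 25) ∧ ∀ u : ℂ, ‖u‖ = 1 → ∀ x, κ (Literature.Topology.FourManifolds.MMSW.fibreRot (fun _ => u) x) = Literature.Topology.FourManifolds.MMSW.fibreRot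 (fun _ => u) (κ x) :=
  fun k _ hUo hDU => ModelHandles.exists_collar_push k hUo hDU

end Summit.SmoothPoincare4.SmoothPoincare4.Theorems.DcrGap.MkFriends

end
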